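import Literature.NumberTheory.Automorphic.ClozelAlgebraicityCMProofs
import Literature.NumberTheory.Automorphic.LanglandsTetrahedralProofs
import HarnessLib

/-!
# Clozel's algebraicity fact: clause (iv) ("`ℚ(π_f)` is totally real or CM") from clause (i),
# the `Aut(ℂ)`-conjugates and the unramified shadow of `π^∨ ≅ ^cπ ⊗ |det|^{-w}` (proofs)

Proofs-only companion (theorems, no definitions, no named facts) of `ClozelAlgebraicity.lean`,
continuing `ClozelAlgebraicityCMProofs`. There, clause (iv) of `Clozel1990_regularAlgebraic` was
reduced (`isTotallyReal_or_isCMField_ratField_of_isAutConjugate_conj`) to Patrikis's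
"`^{cσ}π ≅ ^{σc}π` for all `σ ∈ Aut(ℂ)`" (Patrikis 2019, proof of Cor. 3.2.3), whose printed source
is: "we may assume `π` is unitary. The `L²` inner product then implies that `π^∨ ≅ ^cπ`". This
file performs that last implication on the carriers of the tree, i.e. on unramified Hecke
eigenvalues. For a cuspidal `π` with `π ⊗ |det|^{-w/2}` unitary (`w ∈ ℤ`; for a regular
algebraic `π` this is Clozel's purity weight, Lemme 4.9) the isomorphism
`(π ⊗ |det|^{-w/2})^∨ ≅ ^c(π ⊗ |det|^{-w/2})`, i.e. `π^∨ ≅ ^cπ ⊗ |det|^{-w}`, reads on the Satake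
parameter `α = t_{π,v}` at an unramified `v`:

  `{ā : a ∈ α} = {q_v^{-w} a⁻¹ : a ∈ α}`                                              (∗)

(contragredient `↔ α⁻¹`, complex conjugate `↔ ᾱ`, `⊗ |det|^{-w}` `↔ q_v^{-w} ·`; for `w = 0` this
is `HasSatakeParameterAt.map_conj_inv_eq` of `LanglandsTetrahedralProofs` in the `L²` model). We
prove:

* `conj_heckeEigenvalueOf_mul_self_of_map_conj` — (∗) in eigenvalues:
  `\overline{t_{v,i}} · t_{v,n} = q_v^{-wi} t_{v,n-i}` (`e_i(α⁻¹) e_n(α) = e_{n-i}(α)`,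
  `esymm_map_inv_mul_prod`);
* `conj_aut_heckeEigenvalueOf_comm` — if (∗) holds for `α` and for a multiset `β` whose
  eigenvalues are `t_{v,i}(β) = σ(t_{v,i}(α))` (the parameter of `^σπ` at `v`), then
  `\overline{σ(t_{v,i}(α))} = σ(\overline{t_{v,i}(α)})`: both sides times `σ(t_{v,n}) ≠ 0` equal
  `q_v^{-wi} σ(t_{v,n-i})`;
* **`isTotallyReal_or_isCMField_ratField_of_conj_shadow`** — if `ratField π` is finite over `ℚ`
  (clause (i)) and for every `σ ∈ Aut(ℂ)` some `σ`-conjugate `π_σ` of `π` at almost all places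
  (clause (ii): `IsAutConjugate σ π π_σ`) satisfies (∗) at almost all places (for one `w ∈ ℤ`
  independent of `σ`), then `ratField π` is totally real or CM. Proof: the `cσ`-conjugate `π_{cσ}`
  has eigenvalues `\overline{σ(t_{v,i})} = σ(\overline{t_{v,i}})` (the lemma, with (∗) for `π_σ`
  and for `π ~ π_1`), so it is also a `σc`-conjugate, and
  `isTotallyReal_or_isCMField_ratField_of_isAutConjugate_conj` applies.

So, for a cuspidal regular algebraic `π`, clause (iv) follows from clauses (i), (ii) and the
relation (∗) for `π` and its conjugates with `w` the purity weight of clause (iii) (the weight is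
the same for `^σπ`: it is `2 ∑_{ι,i} a_{ι,i} / (n [K:ℚ])`, a function of the `a`-multisets, which
`σ` only re-indexes). What is NOT here is (∗) itself for the Borel–Jacquet data of the tree: it
needs the unitarity of `π ⊗ |det|^{-w/2}` on the carriers (the Petersson pairing of
`AutomorphicRepsGLCuspidalUnitary` on a clean, `A_G`-normalised model, or the `L²` dictionary
`exists_isAssociatedL2` / `hasSatakeParamAt_iff_L2`) together with the identification of the
`A_G`-exponent of `π` with `n [K:ℚ] w / 2` (archimedean central character vs. infinity type).

## References

* S. Patrikis, *Variations on a theorem of Tate*, Mem. AMS 258 (2019) = arXiv:1207.6724, §2 and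
  Cor. 3.2.3 with its proof [Patrikis2019].
* L. Clozel, *Motifs et formes automorphes: applications du principe de fonctorialité*, in
  Automorphic forms, Shimura varieties, and L-functions I (Ann Arbor 1988), Academic Press 1990,
  Thm. 3.13, Lemme 4.9 [Clozel1990].
* J. Arthur, L. Clozel, *Simple algebras, base change, and the advanced theory of the trace
  formula*, Annals of Math. Studies 120 (1989), Ch. 3, §2, p. 172 (`t̃_v`, the Hecke matrix of
  the contragredient) [ArthurClozelAMS120].
-/

noncomputable section

open scoped Classical ComplexConjugate
open NumberField IsDedekindDomain

namespace Literature.NumberTheory.Automorphic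

variable {n : ℕ} {K : Type} [Field K] [NumberField K] {hcpt : isCompact_glFiniteIntegralLevel n K}

/-! ### The relation `{ā} = {c a⁻¹}` on unramified Hecke eigenvalues -/

section Eigenvalues

/-- `t_{v,n}(α) = e_n(α)` (`q_v^{n(n-n)/2} = 1`). [folklore] -/
theorem heckeEigenvalueOf_self (v : HeightOneSpectrum (𝓞 K)) (α : Multiset ℂ) :
    heckeEigenvalueOf n v α n = α.esymm n := by
  rw [heckeEigenvalueOf, Nat.sub_self, mul_zero, pow_zero, one_mul]

/-- `e_{#α}(α) = ∏ α`. [folklore] -/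
private theorem esymm_card_eq_prod' (α : Multiset ℂ) : α.esymm (Multiset.card α) = α.prod := by
  rw [Multiset.esymm, Multiset.powersetCard_self, Multiset.map_singleton, Multiset.sum_singleton]

/-- `t_{v,n}(α) = ∏ α ≠ 0` when `#α = n` and `0 ∉ α`. [folklore] -/
theorem heckeEigenvalueOf_self_ne_zero (v : HeightOneSpectrum (𝓞 K)) {α : Multiset ℂ}
    (hcard : Multiset.card α = n) (h0 : ∀ a ∈ α, a ≠ 0) : heckeEigenvalueOf n v α n ≠ 0 := by
  rw [heckeEigenvalueOf_self, ← hcard, esymm_card_eq_prod']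
  exact Multiset.prod_ne_zero fun h ↦ h0 0 h rfl

/-- The eigenvalues of the conjugate multiset are the conjugate eigenvalues:
`t_{v,i}(ᾱ) = \overline{t_{v,i}(α)}` (`q_v^{i(n-i)/2}` is real, `e_i` commutes with ring
homomorphisms). [folklore] -/
theorem heckeEigenvalueOf_map_conj (v : HeightOneSpectrum (𝓞 K)) (α : Multiset ℂ) (i : ℕ) :
    heckeEigenvalueOf n v (α.map conj) i = conj (heckeEigenvalueOf n v α i) := by
  rw [heckeEigenvalueOf, heckeEigenvalueOf, map_mul, map_pow, Complex.conj_ofReal,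
    Multiset.esymm_map_ringHom]

/-- **The relation `{ā : a ∈ α} = {c a⁻¹ : a ∈ α}` in Hecke eigenvalues.** If `#α = n`,
`0 ∉ α` and `ᾱ = c · α⁻¹` as multisets, then `\overline{t_{v,i}(α)} · t_{v,n}(α) = cⁱ t_{v,n-i}(α)`
for `i ≤ n`: `e_i(ᾱ) = e_i(c α⁻¹) = cⁱ e_i(α⁻¹)` (`esymm_map_const_mul`), `e_i(α⁻¹) e_n(α) =
e_{n-i}(α)` (`esymm_map_inv_mul_prod`) and `q_v^{i(n-i)/2} = q_v^{(n-i)(n-(n-i))/2}`. For the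
Satake parameter of a cuspidal `π` with `π ⊗ |det|^{-w/2}` unitary and `c = q_v^{-w}` this is
`t̃_v = \bar t_v` up to the twist (Arthur–Clozel 1989, Ch. 3, p. 172). [folklore] -/
theorem conj_heckeEigenvalueOf_mul_self_of_map_conj {v : HeightOneSpectrum (𝓞 K)}
    {α : Multiset ℂ} (hcard : Multiset.card α = n) (h0 : ∀ a ∈ α, a ≠ 0) {c : ℂ}
    (h : α.map conj = α.map (c * ·⁻¹)) {i : ℕ} (hi : i ≤ n) :
    conj (heckeEigenvalueOf n v α i) * heckeEigenvalueOf n v α n =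
      c ^ i * heckeEigenvalueOf n v α (n - i) := by
  have hmap : α.map (c * ·⁻¹) = (α.map (·⁻¹)).map (c * ·) := by
    rw [Multiset.map_map]
    rfl
  have hprod : α.esymm n = α.prod := by rw [← hcard, esymm_card_eq_prod']
  have key : (α.map (·⁻¹)).esymm i * α.esymm n = α.esymm (n - i) := by
    rw [hprod]
    exact esymm_map_inv_mul_prod α h0 (by omega)
  have hexp : (n - i) * (n - (n - i)) = i * (n - i) := by
    rw [Nat.sub_sub_self hi, Nat.mul_comm]
  rw [← heckeEigenvalueOf_map_conj, h, hmap, heckeEigenvalueOf_self]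
  unfold heckeEigenvalueOf
  rw [esymm_map_const_mul, hexp]
  linear_combination ((((Real.sqrt (v.residueCard : ℝ)) : ℝ) : ℂ) ^ (i * (n - i)) * c ^ i) * key

/-- **Complex conjugation commutes with `σ` on the Hecke eigenvalues.** Let `α, β` be multisets
of cardinality `n` without `0`, both satisfying `{x̄} = {c x⁻¹}` for one `c` with `σ c = c`, and
suppose the eigenvalues of `β` are the `σ`-conjugates of those of `α`, `t_{v,i}(β) = σ(t_{v,i}(α))`
for `i ≤ n` (the Satake parameters at `v` of `π` and of `^σπ`). Then
`\overline{σ(t_{v,i}(α))} = σ(\overline{t_{v,i}(α)})`: by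
`conj_heckeEigenvalueOf_mul_self_of_map_conj` for `β` and for `α`, both sides multiplied by
`σ(t_{v,n}(α)) = t_{v,n}(β) ≠ 0` equal `cⁱ σ(t_{v,n-i}(α))`. This is "`π^∨ ≅ ^cπ` … implies
`^{cσ}π ≅ ^{σc}π`" (Patrikis 2019, proof of Cor. 3.2.3) at one unramified place.
[cite: Patrikis2019, Cor. 3.2.3 (arXiv:1207.6724)] -/
theorem conj_aut_heckeEigenvalueOf_comm {v : HeightOneSpectrum (𝓞 K)} {α β : Multiset ℂ}
    (hα : Multiset.card α = n) (hβ : Multiset.card β = n) (hα0 : ∀ a ∈ α, a ≠ 0)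
    (hβ0 : ∀ b ∈ β, b ≠ 0) {c : ℂ} (σ : ℂ ≃ₐ[ℚ] ℂ) (hσc : σ c = c)
    (hαc : α.map conj = α.map (c * ·⁻¹)) (hβc : β.map conj = β.map (c * ·⁻¹))
    (hσ : ∀ i ≤ n, heckeEigenvalueOf n v β i = σ (heckeEigenvalueOf n v α i)) {i : ℕ}
    (hi : i ≤ n) :
    conj (σ (heckeEigenvalueOf n v α i)) = σ (conj (heckeEigenvalueOf n v α i)) := by
  have htn : σ (heckeEigenvalueOf n v α n) ≠ 0 := by
    rw [← hσ n le_rfl]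
    exact heckeEigenvalueOf_self_ne_zero v hβ hβ0
  have eα := conj_heckeEigenvalueOf_mul_self_of_map_conj (v := v) hα hα0 hαc hi
  have eβ := conj_heckeEigenvalueOf_mul_self_of_map_conj (v := v) hβ hβ0 hβc hi
  rw [hσ i hi, hσ n le_rfl, hσ (n - i) (Nat.sub_le n i)] at eβ
  refine mul_right_cancel₀ htn ?_
  rw [eβ, ← map_mul, eα, map_mul, map_pow, hσc]

end Eigenvalues

/-! ### Clause (iv) from clause (i), the conjugates, and the shadow of `π^∨ ≅ ^cπ ⊗ |det|^{-w}` -/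

section CM

/-- **Clause (iv) of Clozel's fact from clause (i), the `Aut(ℂ)`-conjugates of clause (ii), and
the unramified shadow of `π^∨ ≅ ^cπ ⊗ |det|^{-w}`** (Patrikis 2019, proof of Cor. 3.2.3: "we may
assume `π` is unitary. The `L²` inner product then implies that `π^∨ ≅ ^cπ`, which in turn implies
that for all `σ ∈ Aut(ℂ)`, `^{cσ}π ≅ ^{σc}π`, and therefore that … `ℚ(π_f)` … is CM"). Let `π` be an
automorphic representation of `GL_n(𝔸_K)` with `ratField π` finite over `ℚ`, and `w ∈ ℤ`.
Suppose that for every `σ ∈ Aut(ℂ)` there is a `σ`-conjugate `π_σ` of `π` at almost all places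
(`IsAutConjugate σ π π_σ`) whose Satake parameters `α` satisfy, at almost all places, `0 ∉ α` and
`{ā : a ∈ α} = {q_v^{-w} a⁻¹ : a ∈ α}` — for cuspidal `π_σ` this is the unitarity of
`π_σ ⊗ |det|^{-w/2}` read on unramified components (`w` = Clozel's purity weight when `π` is
regular algebraic). Then `ratField π` is totally real or CM. Indeed `π ~ π_1` gives the relation
for the parameters of `π` itself (`hasSatakeParamAt_unique_holds`, `eq_of_heckeEigenvalueOf_eq`);
by `conj_aut_heckeEigenvalueOf_comm` (with the parameters of `π_σ`, and `σ(q_v^{-w}) = q_v^{-w}`)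
the `cσ`-conjugate `π_{cσ}`, of eigenvalues `\overline{σ(t_{v,i})} = σ(\overline{t_{v,i}})`, is
also a `σc`-conjugate of `π`, which is the hypothesis of
`isTotallyReal_or_isCMField_ratField_of_isAutConjugate_conj`.
[cite: Patrikis2019, Cor. 3.2.3 (arXiv:1207.6724)] -/
theorem isTotallyReal_or_isCMField_ratField_of_conj_shadow
    (π : AutomorphicRepData (AutomorphyDatum.gl n K hcpt)) [FiniteDimensional ℚ (ratField π)]
    (w : ℤ)
    (h : ∀ σ : ℂ ≃ₐ[ℚ] ℂ, ∃ π' : AutomorphicRepData (AutomorphyDatum.gl n K hcpt),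
      IsAutConjugate σ π π' ∧
        ∀ᶠ v : HeightOneSpectrum (𝓞 K) in Filter.cofinite, ∀ α : Multiset ℂ,
          π'.HasSatakeParamAt v α → (∀ a ∈ α, a ≠ 0) ∧
            α.map conj = α.map (fun a ↦ (v.residueCard : ℂ) ^ (-w) * a⁻¹)) :
    IsTotallyReal (ratField π) ∨ IsCMField (ratField π) := by
  refine isTotallyReal_or_isCMField_ratField_of_isAutConjugate_conj π fun σ ↦ ?_
  obtain ⟨π₁, h₁, hp₁⟩ := h σ
  obtain ⟨π', h', -⟩ := h (Complex.conjAe.restrictScalars ℚ * σ)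
  obtain ⟨π₀, h₀, hp₀⟩ := h 1
  refine ⟨π', h', ?_⟩
  change ∀ᶠ v : HeightOneSpectrum (𝓞 K) in Filter.cofinite, _ at h₁ h' h₀ ⊢
  filter_upwards [h', h₁, hp₁, h₀, hp₀] with v hv' hv₁ hvp₁ hv₀ hvp₀
  obtain ⟨α, α', hα, hα', he'⟩ := hv'
  obtain ⟨α₁, β, hα₁, hβ, he₁⟩ := hv₁
  obtain ⟨α₀, γ, hα₀, hγ, he₀⟩ := hv₀
  refine ⟨α, α', hα, hα', fun i hi ↦ ?_⟩
  -- identify the parameters of `π` at `v`, and `γ` (a parameter of the `1`-conjugate) with `α`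
  have hα₁α : α₁ = α := AutomorphicRepData.hasSatakeParamAt_unique_holds π hα₁ hα
  have hα₀α : α₀ = α := AutomorphicRepData.hasSatakeParamAt_unique_holds π hα₀ hα
  have hγα : γ = α :=
    eq_of_heckeEigenvalueOf_eq hγ.card_eq hα.card_eq fun j hj ↦ by
      rw [he₀ j hj, hα₀α, AlgEquiv.one_apply]
  obtain ⟨hγ0, hγc⟩ := hvp₀ γ hγ
  obtain ⟨hβ0, hβc⟩ := hvp₁ β hβ
  rw [hγα] at hγ0 hγc
  rw [hα₁α] at he₁
  have hσq : σ ((v.residueCard : ℂ) ^ (-w)) = (v.residueCard : ℂ) ^ (-w) := by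
    rw [map_zpow₀, map_natCast]
  rw [he' i hi, AlgEquiv.mul_apply, AlgEquiv.mul_apply]
  change conj (σ (heckeEigenvalueOf n v α i)) = σ (conj (heckeEigenvalueOf n v α i))
  exact conj_aut_heckeEigenvalueOf_comm hα.card_eq hβ.card_eq hγ0 hβ0 σ hσq hγc hβc he₁ hi

/-- The same for a **cuspidal** `π` with cuspidal conjugates, in the binder shape of
`Clozel1990_regularAlgebraic` (ii): clause (iv) follows from clause (i), the existence of cuspidal
`σ`-conjugates for all `σ`, and the relation `{ā} = {q_v^{-w} a⁻¹}` at almost all places for every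
cuspidal representation near-equivalent to a conjugate of `π` — stated here simply for the
conjugates provided. (Patrikis 2019, Cor. 3.2.3.) [cite: Patrikis2019, Cor. 3.2.3 (arXiv:1207.6724)] -/
theorem CuspidalAutomorphicRepData.isTotallyReal_or_isCMField_ratField_of_conj_shadow
    (π : CuspidalAutomorphicRepData n K hcpt) [FiniteDimensional ℚ (ratField π.1)] (w : ℤ)
    (h : ∀ σ : ℂ ≃ₐ[ℚ] ℂ, ∃ π' : CuspidalAutomorphicRepData n K hcpt,
      IsAutConjugate σ π.1 π'.1 ∧
        ∀ᶠ v : HeightOneSpectrum (𝓞 K) in Filter.cofinite, ∀ α : Multiset ℂ,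
          π'.1.HasSatakeParamAt v α → (∀ a ∈ α, a ≠ 0) ∧
            α.map conj = α.map (fun a ↦ (v.residueCard : ℂ) ^ (-w) * a⁻¹)) :
    IsTotallyReal (ratField π.1) ∨ IsCMField (ratField π.1) :=
  Literature.NumberTheory.Automorphic.isTotallyReal_or_isCMField_ratField_of_conj_shadow π.1 w
    fun σ ↦
      let ⟨π', h', hp'⟩ := h σ
      ⟨π'.1, h', hp'⟩

end CM

end Literature.NumberTheory.Automorphic
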